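import Mathlib
import HarnessLib
import Summits.HubbardSuperconductivity.HubbardSuperconductivity.Theorems.KLProgrammeC4aTwoPointReadingJets
import Summits.HubbardSuperconductivity.HubbardSuperconductivity.Theorems.KLProgrammeC4aAvg8Jets

/-!
# Route `KLProgramme` — crux C4a, THE (A) CAPSTONE: `TwoLegCurveJetBound L M c c′ β U μ K (n+1)` (the slice-increment half of stub (C) at the fixed frame `K`)
# from NAMED INPUTS ONLY — (L3) co-moving dominators of the continuum tadpole vertex, position-space moments of the two remainder kernels, the Jacobian
# table, the alias tables, the Fermi-point sizes, and one arithmetic fit against the bars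

Cell `gate-hubbard-kl`, lane hubbard-kl-c4a-1 (g5); helper for stub (C) `stub_twoLeg_curvature` of the engine-flow child `KLRegimeEngineV17F2`
(stmt-HubbardSuperconductivity-20437); memo HOME/hubbard-kl-c4a-1/C4A-PLAN.md §22.  The chain
`klLocalPart_succ_sub_eq_avg8` (exact, 8 images) → `localReadingCont_laplacian_klEffectiveAction` (one-line term = continuum tadpole) →
`twoLegCurveJetBound_succ_of_jets` (jets of ONE function) → `abs_iteratedDeriv_re_tadpoleCont_comp_le` (tube theorem + alias) +
`abs_iteratedDeriv_re_localReadingCont_klFermiPoint_le` (remainders from kernel moments), assembled: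

* **`twoLegCurveJetBound_succ_of_inputs`** — at scale `n+1`, frame `K`, with `S = C^K_{(Λ_{n+1},Λ_n]}`, `𝒱_n = klEffectiveAction … K klE0 n`,
  `R₁ = e^{Δ_S}𝒱_n − 𝒱_n − Δ_S𝒱_n`, `R₂ = effAction S 𝒱_n − e^{Δ_S}𝒱_n`: IF
  (i) for every kept frequency `p₀`, `CoMovingJetsL1 4 (aV p₀) r μ K (tadpoleVertex β 𝒱_n p₀)` with `∫dϑ aV p₀ i ≤ Mv p₀ i` uniformly in the level ((L3)),
  (ii) Jacobian jets `≤ G_i` on the tube (`hJjet_cert`), (iii) alias tables `Da p₀` at some `M ≥ 4`, (iv) the Fermi-point map is `C⁴` with sizes `D_i`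
  (`fermiPointLp_sizes_explicit`), and (v) the FIT: for `k ≤ 4`,
  `(2π)⁻²Σ_{p₀}(Σ_{i≤k}C(k,i)G_iMv_{p₀,k−i})∫‖ŝ_{p₀}‖ + bell4(alias) D k + bell4(twoPointMoment R₁) D k + bell4(twoPointMoment R₂) D k ≤ curveJetBar c c′ U k (n+1)`,
  THEN `TwoLegCurveJetBound L M c c′ β U μ K (n+1)`.

With `…C4aReadJetAssembly.twoLegReadJetBound_flow_succ_klC4aJetC` ((A) + (P) ⇒ stub (C)'s literal conclusion) this closes the (A) side of stub (C) MODULO the named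
inputs (i)–(v).  Composition only; nothing is asserted about the Hubbard model's sizes; nothing asserts superconductivity.
References: BGM 2006 §2.4 (2.36)–(2.42) [cite: BenfattoGiulianiMastropietro2006]; FST II CPAM 51 (1998) §3.
-/

noncomputable section

namespace Summit.HubbardSuperconductivity.HubbardSuperconductivity.Theorems.C4a

set_option linter.dupNamespace false -- summit = problem name (single-conjunct summit), D-0017

open Real Set MeasureTheory Finset
open scoped ContDiff
open Literature.MathematicalPhysics.QuantumLattice Literature.MathematicalPhysics.QuantumLattice.BandSectorCounting Literature.Probability.LatticeModels
open GrassmannAlgebra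
open Summit.HubbardSuperconductivity.HubbardSuperconductivity.Theorems.KLRegimeSplit
open Summit.HubbardSuperconductivity.HubbardSuperconductivity.Theorems.KLProgrammeLegKernels
open Summit.HubbardSuperconductivity.HubbardSuperconductivity.Theorems.KLRegimeWick
open Summit.HubbardSuperconductivity.HubbardSuperconductivity.Theorems.DispersionFlow
open Summit.HubbardSuperconductivity.HubbardSuperconductivity.Theorems.PerturbedFermiCurve

section Assembly

variable {L M : ℕ} [NeZero L] [NeZero M]
variable {a b : ℝ} (B : BandBounds a b) {K : TrigPolyC4v} {A : ℝ}
  (hA : ∀ p : Momentum, ∀ j ≤ 2, ‖iteratedFDeriv ℝ j (frameShift K) p‖ ≤ A) (hADt : 2 * A < B.Dtmin)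
  {μ r : ℝ} (hr : 0 < r) (hlo : a < μ - r - A) (hhi : μ + r + A < b)
include B hA hADt hr hlo hhi

/-- **THE (A) CAPSTONE: `TwoLegCurveJetBound` at scale `n+1` from named inputs.** [cite: BenfattoGiulianiMastropietro2006, §2.4 (2.36)] -/
theorem twoLegCurveJetBound_succ_of_inputs {β : ℝ} (hβ : β ≠ 0) (U : ℝ) (n : ℕ)
    (hΛ : 0 < klScale klE0 (n + 1)) (hΛΛ' : klScale klE0 (n + 1) ≤ klScale klE0 n) (hΛr : klScale klE0 n < r)
    (hZ : hubbardEffPartitionFnCT L M β U μ 0 K (klScale klE0 n) ≠ 0)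
    -- (ii) Jacobian jets on the tube
    {G : ℕ → ℝ} (hJjet : ∀ ρ, |ρ| < r → ∀ i ≤ 4, ∀ s, ‖iteratedDeriv i (fun s => levelChartJac μ K (ρ, s)) s‖ ≤ G i)
    -- (i) the (L3) input: co-moving L¹(dϑ) dominators of the continuum tadpole vertex, per kept frequency
    {aV : MatsubaraIdx M → ℕ → ℝ × ℝ → ℝ}
    (hVJ : ∀ p₀ : MatsubaraIdx M, CoMovingJetsL1 4 (aV p₀) r μ K (tadpoleVertex β (klEffectiveAction L M β U μ K klE0 n) p₀))
    {Mv : MatsubaraIdx M → ℕ → ℝ} (hMv : ∀ (p₀ : MatsubaraIdx M), ∀ i ≤ 4, ∀ ρ ∈ Ioo (-r) r, ∫ ϑ in Ioc 0 (2 * π), aV p₀ i (ρ, ϑ) ≤ Mv p₀ i)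
    -- (iii) alias derivative tables
    {Mdeg : ℕ} (hM : 4 ≤ Mdeg) {Da : MatsubaraIdx M → ℝ}
    (hDa : ∀ (p₀ : MatsubaraIdx M) (y : Momentum), ‖iteratedFDeriv ℝ Mdeg (fun y : Momentum =>
      sliceSymbolFnXi (β * (L : ℝ) ^ 2) 0 (klScale klE0 (n + 1)) (klScale klE0 n) (matsubaraFreq β M p₀) (frameLevel μ K ((2 * π) • y))) y‖ ≤ Da p₀)
    -- (iv) the Fermi-point map and its sizes
    (hγ : ContDiff ℝ 4 fun θ : ℝ => (WithLp.toLp 2 (klFermiPoint μ K θ) : Momentum)) {D : ℕ → ℝ}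
    (hD : ∀ θ : ℝ, ∀ i, 1 ≤ i → i ≤ 4 → ‖iteratedDeriv i (fun θ : ℝ => (WithLp.toLp 2 (klFermiPoint μ K θ) : Momentum)) θ‖ ≤ D i)
    -- the alias Bell constants
    {Mk : ℕ → ℝ}
    (hMk : ∀ k, Mk k = (L : ℝ) ^ k * (6 * |β| * (L : ℝ) ^ 4 * ∑ σ : Fin 2, ∑ τ : Fin 2, 2 * (((Fintype.card (SpaceTimeIdx L M) : ℝ) ^ 4)⁻¹ *
        ∑ x : Fin 4 → SpaceTimeIdx L M, ‖positionKernel L M β (klEffectiveAction L M β U μ K klE0 n) 4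
          (fun i => ((x i, ![σ, σ, τ, τ] i), (![0, 1, 1, 0] : Fin 4 → Fin 2) i))‖)) *
          ∑ p₀ : MatsubaraIdx M, Da p₀ / (2 * Real.pi) ^ Mdeg * (2 / (L : ℝ)) ^ (Mdeg - 4) * (4 * ∑' k : Fin 2 → ℤ, ∏ j, (1 + (k j : ℝ) ^ 2)⁻¹))
    -- (v) the fit against the bars
    {c c' : ℕ → ℝ}
    (hfit : ∀ k ≤ 4,
      ((2 * π) ^ 2)⁻¹ * (∑ p₀ : MatsubaraIdx M, (∑ i ∈ Finset.range (k + 1), (k.choose i : ℝ) * G i * Mv p₀ (k - i)) *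
          ∫ ρ in Ioo (-r) r, ‖sliceSymbolFnXi (β * (L : ℝ) ^ 2) 0 (klScale klE0 (n + 1)) (klScale klE0 n) (matsubaraFreq β M p₀) ρ‖) +
        bell4 Mk D k +
        bell4 (twoPointMoment β
          (gaussConv ℂ (hubbardCovSliceCT L M β μ 0 K (klScale klE0 (n + 1)) (klScale klE0 n)) (klEffectiveAction L M β U μ K klE0 n) -
            klEffectiveAction L M β U μ K klE0 n -
            grassmannLaplacian ℂ (hubbardCovSliceCT L M β μ 0 K (klScale klE0 (n + 1)) (klScale klE0 n))
              (klEffectiveAction L M β U μ K klE0 n))) D k +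
        bell4 (twoPointMoment β
          (effAction ℂ (hubbardCovSliceCT L M β μ 0 K (klScale klE0 (n + 1)) (klScale klE0 n)) (klEffectiveAction L M β U μ K klE0 n) -
            gaussConv ℂ (hubbardCovSliceCT L M β μ 0 K (klScale klE0 (n + 1)) (klScale klE0 n)) (klEffectiveAction L M β U μ K klE0 n))) D k ≤
      curveJetBar c c' U k (n + 1)) :
    TwoLegCurveJetBound L M c c' β U μ K (n + 1) := by
  have hlo' : a ≤ μ - A := by linarith
  have hhi' : μ + A ≤ b := by linarith
  -- the three Grassmann elements and the three readings
  obtain ⟨W, hW⟩ : ∃ W : HubbardGrassmann L M, W = klEffectiveAction L M β U μ K klE0 n := ⟨_, rfl⟩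
  obtain ⟨R₁, hR₁⟩ : ∃ R₁ : HubbardGrassmann L M, R₁ =
      gaussConv ℂ (hubbardCovSliceCT L M β μ 0 K (klScale klE0 (n + 1)) (klScale klE0 n)) (klEffectiveAction L M β U μ K klE0 n) -
        klEffectiveAction L M β U μ K klE0 n -
        grassmannLaplacian ℂ (hubbardCovSliceCT L M β μ 0 K (klScale klE0 (n + 1)) (klScale klE0 n)) (klEffectiveAction L M β U μ K klE0 n) :=
    ⟨_, rfl⟩
  obtain ⟨R₂, hR₂⟩ : ∃ R₂ : HubbardGrassmann L M, R₂ =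
      effAction ℂ (hubbardCovSliceCT L M β μ 0 K (klScale klE0 (n + 1)) (klScale klE0 n)) (klEffectiveAction L M β U μ K klE0 n) -
        gaussConv ℂ (hubbardCovSliceCT L M β μ 0 K (klScale klE0 (n + 1)) (klScale klE0 n)) (klEffectiveAction L M β U μ K klE0 n) := ⟨_, rfl⟩
  rw [← hW] at hVJ hMk
  rw [← hR₁, ← hR₂] at hfit
  -- the one function and its three smooth summands
  set T : (Fin 2 → ℝ) → ℂ := fun P =>
    tadpoleCont β μ K (klScale klE0 (n + 1)) (klScale klE0 n) W P + localReadingCont β R₁ P + localReadingCont β R₂ P with hTdef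
  have hT : T = fun P =>
      tadpoleCont β μ K (klScale klE0 (n + 1)) (klScale klE0 n) (klEffectiveAction L M β U μ K klE0 n) P +
        localReadingCont β
          (gaussConv ℂ (hubbardCovSliceCT L M β μ 0 K (klScale klE0 (n + 1)) (klScale klE0 n)) (klEffectiveAction L M β U μ K klE0 n) -
            klEffectiveAction L M β U μ K klE0 n -
            grassmannLaplacian ℂ (hubbardCovSliceCT L M β μ 0 K (klScale klE0 (n + 1)) (klScale klE0 n))
              (klEffectiveAction L M β U μ K klE0 n)) P +
        localReadingCont β
          (effAction ℂ (hubbardCovSliceCT L M β μ 0 K (klScale klE0 (n + 1)) (klScale klE0 n)) (klEffectiveAction L M β U μ K klE0 n) -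
            gaussConv ℂ (hubbardCovSliceCT L M β μ 0 K (klScale klE0 (n + 1)) (klScale klE0 n)) (klEffectiveAction L M β U μ K klE0 n)) P := by
    rw [hTdef, hW, hR₁, hR₂]
  have h1 : ContDiff ℝ 4 fun θ : ℝ => (tadpoleCont β μ K (klScale klE0 (n + 1)) (klScale klE0 n) W (klFermiPoint μ K θ)).re :=
    IsCharPoly.contDiff_re_comp_klFermiPoint B hA hADt hlo' hhi' (isCharPoly_tadpoleCont β μ K _ _ W)
  have h2 : ContDiff ℝ 4 fun θ : ℝ => (localReadingCont β R₁ (klFermiPoint μ K θ)).re :=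
    IsCharPoly.contDiff_re_comp_klFermiPoint B hA hADt hlo' hhi' (isCharPoly_localReadingCont β R₁)
  have h3 : ContDiff ℝ 4 fun θ : ℝ => (localReadingCont β R₂ (klFermiPoint μ K θ)).re :=
    IsCharPoly.contDiff_re_comp_klFermiPoint B hA hADt hlo' hhi' (isCharPoly_localReadingCont β R₂)
  have hsplit : (fun θ' : ℝ => (T (klFermiPoint μ K θ')).re) = fun θ' : ℝ =>
      (tadpoleCont β μ K (klScale klE0 (n + 1)) (klScale klE0 n) W (klFermiPoint μ K θ')).re +
        (localReadingCont β R₁ (klFermiPoint μ K θ')).re + (localReadingCont β R₂ (klFermiPoint μ K θ')).re := by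
    funext θ'
    rw [hTdef]
    simp only [Complex.add_re]
  refine twoLegCurveJetBound_succ_of_jets B hA hADt hlo' hhi' hβ U n hZ hT fun k hk θ => ?_
  have hk' : (k : WithTop ℕ∞) ≤ 4 := by exact_mod_cast hk
  rw [hsplit, iteratedDeriv_fun_add ((h1.add h2).contDiffAt.of_le hk') (h3.contDiffAt.of_le hk'),
    iteratedDeriv_fun_add (h1.contDiffAt.of_le hk') (h2.contDiffAt.of_le hk')]
  refine le_trans ?_ (hfit k hk)
  refine (abs_add_le _ _).trans (add_le_add ((abs_add_le _ _).trans (add_le_add ?_ ?_)) ?_)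
  · exact abs_iteratedDeriv_re_tadpoleCont_comp_le B hA hADt hr hlo hhi hβ hΛ hΛΛ' hΛr W le_rfl hJjet hVJ hMv hM hDa hγ (hD θ) hMk hk
  · exact abs_iteratedDeriv_re_localReadingCont_klFermiPoint_le β μ K R₁ hγ (hD θ) hk
  · exact abs_iteratedDeriv_re_localReadingCont_klFermiPoint_le β μ K R₂ hγ (hD θ) hk

/-! ## §2 The same with the VALUE line (`k = 0`) supplied separately

The tube-jet line at `k = 0` is the slice MASS law `4^{−n}` (memo §17.1), one power short of the slot's `16^{−n}`; the honest `k = 0` input is the PAIRED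
value bound of `…C4aTadpoleValueAssembly` (or any other value bound `V₀`).  This form takes the one-line value bound as a separate hypothesis and uses the
tube-jet line only for `1 ≤ k ≤ 4`. -/

/-- **THE (A) CAPSTONE, value-flexible form.**  As `twoLegCurveJetBound_succ_of_inputs`, but the `k = 0` line of the one-line term is a separate hypothesis
`|Re tadpoleCont(k_F θ)| ≤ V₀` (e.g. `norm_localReadingCont_laplacian_le_of_linear_oddDiff` through `localReadingCont_laplacian_klEffectiveAction`), fitted with the
remainder values against `curveJetBar c c′ U 0 (n+1)`; the tube-jet fit is asked only for `1 ≤ k ≤ 4`. [cite: BenfattoGiulianiMastropietro2006, §2.4 (2.36)] -/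
theorem twoLegCurveJetBound_succ_of_inputs_value {β : ℝ} (hβ : β ≠ 0) (U : ℝ) (n : ℕ)
    (hΛ : 0 < klScale klE0 (n + 1)) (hΛΛ' : klScale klE0 (n + 1) ≤ klScale klE0 n) (hΛr : klScale klE0 n < r)
    (hZ : hubbardEffPartitionFnCT L M β U μ 0 K (klScale klE0 n) ≠ 0)
    {G : ℕ → ℝ} (hJjet : ∀ ρ, |ρ| < r → ∀ i ≤ 4, ∀ s, ‖iteratedDeriv i (fun s => levelChartJac μ K (ρ, s)) s‖ ≤ G i)
    {aV : MatsubaraIdx M → ℕ → ℝ × ℝ → ℝ}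
    (hVJ : ∀ p₀ : MatsubaraIdx M, CoMovingJetsL1 4 (aV p₀) r μ K (tadpoleVertex β (klEffectiveAction L M β U μ K klE0 n) p₀))
    {Mv : MatsubaraIdx M → ℕ → ℝ} (hMv : ∀ (p₀ : MatsubaraIdx M), ∀ i ≤ 4, ∀ ρ ∈ Ioo (-r) r, ∫ ϑ in Ioc 0 (2 * π), aV p₀ i (ρ, ϑ) ≤ Mv p₀ i)
    {Mdeg : ℕ} (hM : 4 ≤ Mdeg) {Da : MatsubaraIdx M → ℝ}
    (hDa : ∀ (p₀ : MatsubaraIdx M) (y : Momentum), ‖iteratedFDeriv ℝ Mdeg (fun y : Momentum =>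
      sliceSymbolFnXi (β * (L : ℝ) ^ 2) 0 (klScale klE0 (n + 1)) (klScale klE0 n) (matsubaraFreq β M p₀) (frameLevel μ K ((2 * π) • y))) y‖ ≤ Da p₀)
    (hγ : ContDiff ℝ 4 fun θ : ℝ => (WithLp.toLp 2 (klFermiPoint μ K θ) : Momentum)) {D : ℕ → ℝ}
    (hD : ∀ θ : ℝ, ∀ i, 1 ≤ i → i ≤ 4 → ‖iteratedDeriv i (fun θ : ℝ => (WithLp.toLp 2 (klFermiPoint μ K θ) : Momentum)) θ‖ ≤ D i)
    {Mk : ℕ → ℝ}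
    (hMk : ∀ k, Mk k = (L : ℝ) ^ k * (6 * |β| * (L : ℝ) ^ 4 * ∑ σ : Fin 2, ∑ τ : Fin 2, 2 * (((Fintype.card (SpaceTimeIdx L M) : ℝ) ^ 4)⁻¹ *
        ∑ x : Fin 4 → SpaceTimeIdx L M, ‖positionKernel L M β (klEffectiveAction L M β U μ K klE0 n) 4
          (fun i => ((x i, ![σ, σ, τ, τ] i), (![0, 1, 1, 0] : Fin 4 → Fin 2) i))‖)) *
          ∑ p₀ : MatsubaraIdx M, Da p₀ / (2 * Real.pi) ^ Mdeg * (2 / (L : ℝ)) ^ (Mdeg - 4) * (4 * ∑' k : Fin 2 → ℤ, ∏ j, (1 + (k j : ℝ) ^ 2)⁻¹))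
    -- the one-line VALUE bound, uniformly in the angle
    {V₀ : ℝ} (hV₀ : ∀ θ : ℝ, |(tadpoleCont β μ K (klScale klE0 (n + 1)) (klScale klE0 n) (klEffectiveAction L M β U μ K klE0 n) (klFermiPoint μ K θ)).re| ≤ V₀)
    {c c' : ℕ → ℝ}
    (hfit0 : V₀ +
        bell4 (twoPointMoment β
          (gaussConv ℂ (hubbardCovSliceCT L M β μ 0 K (klScale klE0 (n + 1)) (klScale klE0 n)) (klEffectiveAction L M β U μ K klE0 n) -
            klEffectiveAction L M β U μ K klE0 n -
            grassmannLaplacian ℂ (hubbardCovSliceCT L M β μ 0 K (klScale klE0 (n + 1)) (klScale klE0 n))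
              (klEffectiveAction L M β U μ K klE0 n))) D 0 +
        bell4 (twoPointMoment β
          (effAction ℂ (hubbardCovSliceCT L M β μ 0 K (klScale klE0 (n + 1)) (klScale klE0 n)) (klEffectiveAction L M β U μ K klE0 n) -
            gaussConv ℂ (hubbardCovSliceCT L M β μ 0 K (klScale klE0 (n + 1)) (klScale klE0 n)) (klEffectiveAction L M β U μ K klE0 n))) D 0 ≤
      curveJetBar c c' U 0 (n + 1))
    (hfit : ∀ k, 1 ≤ k → k ≤ 4 →
      ((2 * π) ^ 2)⁻¹ * (∑ p₀ : MatsubaraIdx M, (∑ i ∈ Finset.range (k + 1), (k.choose i : ℝ) * G i * Mv p₀ (k - i)) *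
          ∫ ρ in Ioo (-r) r, ‖sliceSymbolFnXi (β * (L : ℝ) ^ 2) 0 (klScale klE0 (n + 1)) (klScale klE0 n) (matsubaraFreq β M p₀) ρ‖) +
        bell4 Mk D k +
        bell4 (twoPointMoment β
          (gaussConv ℂ (hubbardCovSliceCT L M β μ 0 K (klScale klE0 (n + 1)) (klScale klE0 n)) (klEffectiveAction L M β U μ K klE0 n) -
            klEffectiveAction L M β U μ K klE0 n -
            grassmannLaplacian ℂ (hubbardCovSliceCT L M β μ 0 K (klScale klE0 (n + 1)) (klScale klE0 n))
              (klEffectiveAction L M β U μ K klE0 n))) D k +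
        bell4 (twoPointMoment β
          (effAction ℂ (hubbardCovSliceCT L M β μ 0 K (klScale klE0 (n + 1)) (klScale klE0 n)) (klEffectiveAction L M β U μ K klE0 n) -
            gaussConv ℂ (hubbardCovSliceCT L M β μ 0 K (klScale klE0 (n + 1)) (klScale klE0 n)) (klEffectiveAction L M β U μ K klE0 n))) D k ≤
      curveJetBar c c' U k (n + 1)) :
    TwoLegCurveJetBound L M c c' β U μ K (n + 1) := by
  have hlo' : a ≤ μ - A := by linarith
  have hhi' : μ + A ≤ b := by linarith
  obtain ⟨W, hW⟩ : ∃ W : HubbardGrassmann L M, W = klEffectiveAction L M β U μ K klE0 n := ⟨_, rfl⟩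
  obtain ⟨R₁, hR₁⟩ : ∃ R₁ : HubbardGrassmann L M, R₁ =
      gaussConv ℂ (hubbardCovSliceCT L M β μ 0 K (klScale klE0 (n + 1)) (klScale klE0 n)) (klEffectiveAction L M β U μ K klE0 n) -
        klEffectiveAction L M β U μ K klE0 n -
        grassmannLaplacian ℂ (hubbardCovSliceCT L M β μ 0 K (klScale klE0 (n + 1)) (klScale klE0 n)) (klEffectiveAction L M β U μ K klE0 n) :=
    ⟨_, rfl⟩
  obtain ⟨R₂, hR₂⟩ : ∃ R₂ : HubbardGrassmann L M, R₂ =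
      effAction ℂ (hubbardCovSliceCT L M β μ 0 K (klScale klE0 (n + 1)) (klScale klE0 n)) (klEffectiveAction L M β U μ K klE0 n) -
        gaussConv ℂ (hubbardCovSliceCT L M β μ 0 K (klScale klE0 (n + 1)) (klScale klE0 n)) (klEffectiveAction L M β U μ K klE0 n) := ⟨_, rfl⟩
  rw [← hW] at hVJ hMk hV₀
  rw [← hR₁, ← hR₂] at hfit hfit0
  set T : (Fin 2 → ℝ) → ℂ := fun P =>
    tadpoleCont β μ K (klScale klE0 (n + 1)) (klScale klE0 n) W P + localReadingCont β R₁ P + localReadingCont β R₂ P with hTdef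
  have hT : T = fun P =>
      tadpoleCont β μ K (klScale klE0 (n + 1)) (klScale klE0 n) (klEffectiveAction L M β U μ K klE0 n) P +
        localReadingCont β
          (gaussConv ℂ (hubbardCovSliceCT L M β μ 0 K (klScale klE0 (n + 1)) (klScale klE0 n)) (klEffectiveAction L M β U μ K klE0 n) -
            klEffectiveAction L M β U μ K klE0 n -
            grassmannLaplacian ℂ (hubbardCovSliceCT L M β μ 0 K (klScale klE0 (n + 1)) (klScale klE0 n))
              (klEffectiveAction L M β U μ K klE0 n)) P +
        localReadingCont β
          (effAction ℂ (hubbardCovSliceCT L M β μ 0 K (klScale klE0 (n + 1)) (klScale klE0 n)) (klEffectiveAction L M β U μ K klE0 n) -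
            gaussConv ℂ (hubbardCovSliceCT L M β μ 0 K (klScale klE0 (n + 1)) (klScale klE0 n)) (klEffectiveAction L M β U μ K klE0 n)) P := by
    rw [hTdef, hW, hR₁, hR₂]
  have h1 : ContDiff ℝ 4 fun θ : ℝ => (tadpoleCont β μ K (klScale klE0 (n + 1)) (klScale klE0 n) W (klFermiPoint μ K θ)).re :=
    IsCharPoly.contDiff_re_comp_klFermiPoint B hA hADt hlo' hhi' (isCharPoly_tadpoleCont β μ K _ _ W)
  have h2 : ContDiff ℝ 4 fun θ : ℝ => (localReadingCont β R₁ (klFermiPoint μ K θ)).re :=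
    IsCharPoly.contDiff_re_comp_klFermiPoint B hA hADt hlo' hhi' (isCharPoly_localReadingCont β R₁)
  have h3 : ContDiff ℝ 4 fun θ : ℝ => (localReadingCont β R₂ (klFermiPoint μ K θ)).re :=
    IsCharPoly.contDiff_re_comp_klFermiPoint B hA hADt hlo' hhi' (isCharPoly_localReadingCont β R₂)
  have hsplit : (fun θ' : ℝ => (T (klFermiPoint μ K θ')).re) = fun θ' : ℝ =>
      (tadpoleCont β μ K (klScale klE0 (n + 1)) (klScale klE0 n) W (klFermiPoint μ K θ')).re +
        (localReadingCont β R₁ (klFermiPoint μ K θ')).re + (localReadingCont β R₂ (klFermiPoint μ K θ')).re := by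
    funext θ'
    rw [hTdef]
    simp only [Complex.add_re]
  refine twoLegCurveJetBound_succ_of_jets B hA hADt hlo' hhi' hβ U n hZ hT fun k hk θ => ?_
  have hk' : (k : WithTop ℕ∞) ≤ 4 := by exact_mod_cast hk
  rw [hsplit, iteratedDeriv_fun_add ((h1.add h2).contDiffAt.of_le hk') (h3.contDiffAt.of_le hk'),
    iteratedDeriv_fun_add (h1.contDiffAt.of_le hk') (h2.contDiffAt.of_le hk')]
  refine (abs_add_le _ _).trans ((add_le_add ((abs_add_le _ _).trans (add_le_add le_rfl
    (abs_iteratedDeriv_re_localReadingCont_klFermiPoint_le β μ K R₁ hγ (hD θ) hk)))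
    (abs_iteratedDeriv_re_localReadingCont_klFermiPoint_le β μ K R₂ hγ (hD θ) hk)).trans ?_)
  rcases Nat.eq_zero_or_pos k with hk0 | hk1
  · subst hk0
    simp only [iteratedDeriv_zero]
    exact le_trans (by linarith [hV₀ θ]) hfit0
  · have htad := abs_iteratedDeriv_re_tadpoleCont_comp_le B hA hADt hr hlo hhi hβ hΛ hΛΛ' hΛr W le_rfl hJjet hVJ hMv hM hDa hγ (hD θ) hMk hk
    exact le_trans (by linarith [htad]) (hfit k hk1 hk)

end Assembly

end Summit.HubbardSuperconductivity.HubbardSuperconductivity.Theorems.C4a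

end
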